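import Summits.BirchSwinnertonDyer.BirchSwinnertonDyer.Theses.ThetaPartnerAtTwo
import Summits.BirchSwinnertonDyer.BirchSwinnertonDyer.Theorems.ThetaPartnerAtTwoSignedTransportAtTwoBridgeOrientedResidual
import Summits.BirchSwinnertonDyer.BirchSwinnertonDyer.Theorems.ThetaPartnerAtTwoSignedTransportAtTwoBridge
import Summits.BirchSwinnertonDyer.BirchSwinnertonDyer.Theorems.ThetaPartnerAtTwoSignedTransportAtTwoResidualKummer
import Summits.BirchSwinnertonDyer.BirchSwinnertonDyer.Theorems.ThetaPartnerAtTwoSignedTransportAtTwoResidualTransport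
import Summits.BirchSwinnertonDyer.BirchSwinnertonDyer.Theorems.ThetaPartnerAtTwoSignedTransportAtTwoStubSel2U
import Summits.BirchSwinnertonDyer.BirchSwinnertonDyer.Theorems.ThetaPartnerAtTwoSignedTransportAtTwoStubSel2L0
import Summits.BirchSwinnertonDyer.BirchSwinnertonDyer.Theorems.ThetaPartnerAtTwoSignedTransportAtTwoStubSel2F
import Summits.BirchSwinnertonDyer.BirchSwinnertonDyer.Theorems.ThetaPartnerAtTwoSignedTransportAtTwoResidualTransportPoints
import Summits.BirchSwinnertonDyer.BirchSwinnertonDyer.Theorems.ThetaPartnerAtTwoSignedTransportAtTwoEquivariantSignedLocalPoints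
import Literature.NumberTheory.EllipticCurves.GreenbergVatsal2000.GreenbergSelmerGroups
import Summits.BirchSwinnertonDyer.BirchSwinnertonDyer.Theorems.KatoDescentPotSupersingularFineSelmerLeSignedSelmerTools
import HarnessLib

/-!
# `SignedTransportAtTwoGlue` (item stmt-BirchSwinnertonDyer-21417, route `ThetaPartnerAtTwo`; glue of the W-23 split of the crux K1
# `SignedTransportAtTwo` stmt-BirchSwinnertonDyer-20333 into `ResidualLocalTransportAtTwo` (21414) / `LambdaDifferenceAtTwo` (21415) /
# `MazurTateCongruenceAtTwoR` (21416)) — PROVED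
# (lead prover bsd-wall-tp2-p1 g5; closes stmt-BirchSwinnertonDyer-21417; glue certificate drafted by refuter bsd-vet-tp2r3 g0
# from the lead's registered skeleton of record `SignedTransportAtTwo_bridge_v16.lean`, sha16 9e593aaa9ae27916, evidence #50 on stmt-20333)

HONEST FRAMING. This file is the registered skeleton of line `bridge` (v16/v17) with its `sorry` stubs DELETED and replaced by the
route's CHILD DECLS as hypotheses: `stub_sel2Tb` ↦ `(hTb : ResidualLocalTransportAtTwo)` threaded through `sel2Ta_of_Tb` /
`sel2T_of_Ta` / `sel2_of_UTL`, `stub_lam2d` ↦ `LambdaDifferenceAtTwo`, `stub_V2mtR` ↦ `MazurTateCongruenceAtTwoR`; the final theorem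
`signedTransportAtTwoGlue_proof` has type LITERALLY the route decl `SignedTransportAtTwoGlue` and is sorry-free.  It proves an
IMPLICATION only: the crux `SignedTransportAtTwo` follows once the three children are proved (21414 is: `stub_sel2Tb`, p570334;
21415 / 21416 are open).  BSD is not proved by any of this.
-/


/-!
# Skeleton — crux `SignedTransportAtTwo` (stmt-BirchSwinnertonDyer-20333), line `bridge` v16 (= v15 with the signed-local-points lemma imported from the landed helper p556381; stubs stub_sel2Tb / stub_lam2d / stub_V2mtR; every other declaration proved)
(lead prover bsd-wall-tp2-p1 g4). v8 (g3, 1077b189437a736f) with the algebraic `μ`-stub `stub_sel2` RESHAPED at the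
skeleton level into three registered stubs along the Greenberg–Vatsal / B. D. Kim residual devissage READ AT `2`:

* `stub_sel2U` (UPPER containment, curve side): every residual class whose Kummer image lies in `Sel⁺(W/ℚ_∞)` is
  unramified outside `S₀ ∪ {2}`, residually trivial at the archimedean places, and satisfies the signed Kummer
  condition at `2` with respect to `⨆ₙ E⁺(ℚ_{n,2})`;
* `stub_sel2T` (TRANSPORT of the signed local condition at `2` along an equivariant `W[2^∞][2] ≃ A[2^∞][2]`: the
  HEART — Kim 2009 Prop. 2.9–2.12 / Kobayashi §8 READ AT `2`, formal groups of Honda type `X² + 2`);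
* `stub_sel2L` (LOWER finiteness, CM side): finiteness of the residual preimage of `Sel⁺(A/ℚ_∞)` implies finiteness
  of the bigger residual group cut out by the three transportable conditions (imprimitivity at `S₀` costs a finite
  index; direct-limit bookkeeping over the layers).

The composition `sel2_of_UTL` (PROVED here, no sorry outside `stub_*`) recovers v8's `stub_sel2` verbatim from the
three, through p536648 (`finite_signedSelmerInfty_twoTorsion_iff_finite_comap`), p537955 (`exists_pushH1_bijective`),
p512985 (`exists_admissiblePlaces`) and the naturality of `pushH1` (conjugation, inertia and archimedean restrictions).
Stubs `stub_lam2d`, `stub_V2mtR` and the final composition through `signedTransportAtTwo_of_gvBinders_selmerR` are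
UNCHANGED from v8. Sorries only in `stub_*`.
-/

set_option autoImplicit false
set_option linter.dupNamespace false

noncomputable section

open scoped Classical MatrixGroups ModularForm BigOperators AddSubgroup

open CongruenceSubgroup Polynomial WeierstrassCurve NumberField IsDedekindDomain Rat.HeightOneSpectrum
  Literature Literature.NumberTheory.EllipticCurves Literature.NumberTheory.EllipticCurves.IwasawaAlgebra
  Literature.NumberTheory.EllipticCurves.ModularForms
  Literature.NumberTheory.EllipticCurves.Rank1Residual
  Literature.NumberTheory.EllipticCurves.Kobayashi2003 ZpExtension
  Literature.NumberTheory.EllipticCurves.GreenbergVatsal2000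
  Literature.NumberTheory.EllipticCurves.Sprung2017
  Literature.NumberTheory.GaloisRepresentations
  Summit.BirchSwinnertonDyer.Rank1Residual.X1.MuLambda
  Summit.BirchSwinnertonDyer.Rank1Residual.Supersingular
  Summit.BirchSwinnertonDyer.Rank1Residual.X2.EulerFactorInvariants
  Summit.BirchSwinnertonDyer.BirchSwinnertonDyer.Theorems.TwoAdicTwistConverse
  Summit.BirchSwinnertonDyer.BirchSwinnertonDyer.Theorems.FineSelmerLeSignedSelmer Field

namespace Summit.BirchSwinnertonDyer.BirchSwinnertonDyer.Theorems.SignedTransportAtTwo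
namespace SplitGlue

universe u

/-! ## The three registered stubs replacing v8's `stub_sel2` -/

-- `stub_sel2U` is PROVED: `Theorems/ThetaPartnerAtTwoSignedTransportAtTwoStubSel2U.lean` (p550799), imported above.

/-- **v13's `stub_sel2Ta` from `stub_sel2Tb`** (PROVED): an equivariant `Ψ` automatically carries `W⁺(ℚ_{n,2})` into `A⁺(ℚ_{n,2})`
(`map_signedLocalPointsOfEmb_le`: fixed points and Kobayashi's traces are preserved). -/
theorem sel2Ta_of_Tb (hTb : Summit.BirchSwinnertonDyer.BirchSwinnertonDyer.Theses.ThetaPartnerAtTwo.ResidualLocalTransportAtTwo) :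
    ∀ (W : WeierstrassCurve ℚ) [W.IsElliptic] [W.IsGloballyMinimal] (A : WeierstrassCurve ℚ) [A.IsElliptic]
      [A.IsGloballyMinimal], ¬ W.HasCM → W.analyticRank = 0 → GoodSS W 2 → W.frobeniusTrace 2 = 0 →
      A.HasCM → GoodSS A 2 → A.frobeniusTrace 2 = 0 →
    (∃ e : WeierstrassCurve.geomTorsion W (2 : ℤ) ≃+ WeierstrassCurve.geomTorsion A (2 : ℤ),
      ∀ (σ : Field.absoluteGaloisGroup ℚ) (P : WeierstrassCurve.geomTorsion W (2 : ℤ)), e (σ • P) = σ • e P) →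
    ∀ (κ : ZpExtension ℚ 2), κ.IsCyclotomic →
    ∀ (e' : ↥((↥(W.geomPrimaryTorsion 2))[(2 : ℤ)]) ≃+ ↥((↥(A.geomPrimaryTorsion 2))[(2 : ℤ)]))
      (he' : ∀ (σ : Field.absoluteGaloisGroup ℚ) (x : ↥((↥(W.geomPrimaryTorsion 2))[(2 : ℤ)])), e' (σ • x) = σ • e' x),
    ∀ (v : HeightOneSpectrum (𝓞 ℚ)), ((2 : ℕ) : 𝓞 ℚ) ∈ v.asIdeal →
    ∃ Ψ : localPoints W (v.adicCompletion ℚ) →+ localPoints A (v.adicCompletion ℚ),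
      (∀ (τ : Field.absoluteGaloisGroup (v.adicCompletion ℚ)) (P : localPoints W (v.adicCompletion ℚ)),
          Ψ (τ • P) = τ • Ψ P) ∧
      (∀ n : ℕ, (signedLocalPoints κ (v.adicCompletion ℚ) W 1 n).map Ψ ≤ signedLocalPoints κ (v.adicCompletion ℚ) A 1 n) ∧
      (∀ x : ↥((↥(W.geomPrimaryTorsion 2))[(2 : ℤ)]),
        Ψ (pointsMapOfEmb W (closureEmb (K := ℚ) (v.adicCompletion ℚ)) ((x : W.geomPrimaryTorsion 2) : W.geomPoints)) =
          pointsMapOfEmb A (closureEmb (K := ℚ) (v.adicCompletion ℚ)) ((e' x : A.geomPrimaryTorsion 2) : A.geomPoints)) := by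
  intro W _ _ A _ _ hCM hr hssW ha2W hCMA hssA ha2A he κ hκ e' he' v hv
  obtain ⟨Ψ, hΨ, hΨe⟩ := hTb W A hCM hr hssW ha2W hCMA hssA ha2A he κ hκ e' he' v hv
  exact ⟨Ψ, hΨ, fun n ↦ map_signedLocalPointsOfEmb_le κ (closureEmb (K := ℚ) (v.adicCompletion ℚ)) W A Ψ hΨ 1 n, hΨe⟩

/-- **v9's `stub_sel2T` from `stub_sel2Ta` (= `sel2Ta_of_Tb`)** (PROVED): the signed Kummer condition at `2` over `ℚ_∞` is transported along `Ψ`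
(`pushH1_mem_localKummerOverOfEmb_of_transport`: a residual cocycle's Kummer witness `Q` goes to `Ψ Q`), conjugation commuting with
the Kummer maps and with `ẽ_*` (`pushH1_conjH1`), and `Ψ(⨆ₙ W⁺_n) ≤ ⨆ₙ A⁺_n`. -/
theorem sel2T_of_Ta (hTb : Summit.BirchSwinnertonDyer.BirchSwinnertonDyer.Theses.ThetaPartnerAtTwo.ResidualLocalTransportAtTwo) :
    ∀ (W : WeierstrassCurve ℚ) [W.IsElliptic] [W.IsGloballyMinimal] (A : WeierstrassCurve ℚ) [A.IsElliptic]
      [A.IsGloballyMinimal], ¬ W.HasCM → W.analyticRank = 0 → GoodSS W 2 → W.frobeniusTrace 2 = 0 →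
      A.HasCM → GoodSS A 2 → A.frobeniusTrace 2 = 0 →
    (∃ e : WeierstrassCurve.geomTorsion W (2 : ℤ) ≃+ WeierstrassCurve.geomTorsion A (2 : ℤ),
      ∀ (σ : Field.absoluteGaloisGroup ℚ) (P : WeierstrassCurve.geomTorsion W (2 : ℤ)), e (σ • P) = σ • e P) →
    ∀ (κ : ZpExtension ℚ 2), κ.IsCyclotomic →
    ∀ (e' : ↥((↥(W.geomPrimaryTorsion 2))[(2 : ℤ)]) ≃+ ↥((↥(A.geomPrimaryTorsion 2))[(2 : ℤ)]))
      (he' : ∀ (σ : Field.absoluteGaloisGroup ℚ) (x : ↥((↥(W.geomPrimaryTorsion 2))[(2 : ℤ)])), e' (σ • x) = σ • e' x),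
    ∀ c : subgroupH1 κ.kerSubgroup ↥((↥(W.geomPrimaryTorsion 2))[(2 : ℤ)]),
      (∀ (v : HeightOneSpectrum (𝓞 ℚ)), ((2 : ℕ) : 𝓞 ℚ) ∈ v.asIdeal → ∀ σ : Field.absoluteGaloisGroup ℚ,
          W.conjH1 2 κ.kerSubgroup σ
              (pushH1 κ.kerSubgroup ((↥(W.geomPrimaryTorsion 2))[(2 : ℤ)]).subtype (subtype_torsionBy_smul W 2) c) ∈
            localKummerOverOfEmb W 2 κ.kerSubgroup (closureEmb (K := ℚ) (v.adicCompletion ℚ))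
              (⨆ n : ℕ, signedLocalPoints κ (v.adicCompletion ℚ) W 1 n)) →
      (∀ (v : HeightOneSpectrum (𝓞 ℚ)), ((2 : ℕ) : 𝓞 ℚ) ∈ v.asIdeal → ∀ σ : Field.absoluteGaloisGroup ℚ,
          A.conjH1 2 κ.kerSubgroup σ
              (pushH1 κ.kerSubgroup ((↥(A.geomPrimaryTorsion 2))[(2 : ℤ)]).subtype (subtype_torsionBy_smul A 2)
                (pushH1 κ.kerSubgroup e'.toAddMonoidHom he' c)) ∈
            localKummerOverOfEmb A 2 κ.kerSubgroup (closureEmb (K := ℚ) (v.adicCompletion ℚ))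
              (⨆ n : ℕ, signedLocalPoints κ (v.adicCompletion ℚ) A 1 n)) := by
  intro W _ _ A _ _ hCM hr hssW ha2W hCMA hssA ha2A he κ hκ e' he' c hcW v hv σ
  obtain ⟨Ψ, hΨ, hΨplus, hΨe⟩ := sel2Ta_of_Tb hTb W A hCM hr hssW ha2W hCMA hssA ha2A he κ hκ e' he' v hv
  -- move the conjugation inside both Kummer maps
  have h1 : A.conjH1 2 κ.kerSubgroup σ
      (pushH1 κ.kerSubgroup ((↥(A.geomPrimaryTorsion 2))[(2 : ℤ)]).subtype (subtype_torsionBy_smul A 2)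
        (pushH1 κ.kerSubgroup e'.toAddMonoidHom he' c)) =
      pushH1 κ.kerSubgroup ((↥(A.geomPrimaryTorsion 2))[(2 : ℤ)]).subtype (subtype_torsionBy_smul A 2)
        (Literature.NumberTheory.EllipticCurves.conjH1 κ.kerSubgroup _ σ (pushH1 κ.kerSubgroup e'.toAddMonoidHom he' c)) :=
    (pushH1_conjH1 κ.kerSubgroup ((↥(A.geomPrimaryTorsion 2))[(2 : ℤ)]).subtype (subtype_torsionBy_smul A 2) σ _).symm
  have h2 : Literature.NumberTheory.EllipticCurves.conjH1 κ.kerSubgroup _ σ (pushH1 κ.kerSubgroup e'.toAddMonoidHom he' c) =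
      pushH1 κ.kerSubgroup e'.toAddMonoidHom he'
        (Literature.NumberTheory.EllipticCurves.conjH1 κ.kerSubgroup _ σ c) :=
    (pushH1_conjH1 κ.kerSubgroup e'.toAddMonoidHom he' σ c).symm
  rw [h1, h2]
  have hcW' := hcW v hv σ
  have h3 : W.conjH1 2 κ.kerSubgroup σ
      (pushH1 κ.kerSubgroup ((↥(W.geomPrimaryTorsion 2))[(2 : ℤ)]).subtype (subtype_torsionBy_smul W 2) c) =
      pushH1 κ.kerSubgroup ((↥(W.geomPrimaryTorsion 2))[(2 : ℤ)]).subtype (subtype_torsionBy_smul W 2)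
        (Literature.NumberTheory.EllipticCurves.conjH1 κ.kerSubgroup _ σ c) :=
    (pushH1_conjH1 κ.kerSubgroup ((↥(W.geomPrimaryTorsion 2))[(2 : ℤ)]).subtype (subtype_torsionBy_smul W 2) σ c).symm
  rw [h3] at hcW'
  refine pushH1_mem_localKummerOverOfEmb_of_transport W A 2 κ.kerSubgroup (closureEmb (K := ℚ) (v.adicCompletion ℚ))
    e' he' Ψ hΨ _ _ ?_ hΨe _ hcW'
  rw [AddSubgroup.map_iSup]
  exact iSup_mono fun n ↦ hΨplus n

-- `stub_sel2L0` (p553187) and `stub_sel2F` (StubSel2F.lean) are PROVED and imported above.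

/-- **v9's `stub_sel2L` from (L0, F)** (PROVED): `R(A)` finite ⇒ (L0) the residual group of classes unramified at every odd
place (with (b), (c)) lies in `R(A)`, hence is finite ⇒ (F) `R♯(A)` finite. -/
theorem sel2L_of_L0F :
    ∀ (W : WeierstrassCurve ℚ) [W.IsElliptic] [W.IsGloballyMinimal] (A : WeierstrassCurve ℚ) [A.IsElliptic]
      [A.IsGloballyMinimal], ¬ W.HasCM → W.analyticRank = 0 → GoodSS W 2 → W.frobeniusTrace 2 = 0 →
      A.HasCM → GoodSS A 2 → A.frobeniusTrace 2 = 0 →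
    (∃ e : WeierstrassCurve.geomTorsion W (2 : ℤ) ≃+ WeierstrassCurve.geomTorsion A (2 : ℤ),
      ∀ (σ : Field.absoluteGaloisGroup ℚ) (P : WeierstrassCurve.geomTorsion W (2 : ℤ)), e (σ • P) = σ • e P) →
    ∀ (κ : ZpExtension ℚ 2), κ.IsCyclotomic →
    ∀ (S₀ : Finset (HeightOneSpectrum (𝓞 ℚ))), (∀ v ∈ S₀, ((2 : ℕ) : 𝓞 ℚ) ∉ v.asIdeal) →
      (∀ v : HeightOneSpectrum (𝓞 ℚ), ¬ W.HasGoodReductionAt v → v ∈ S₀) →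
      (∀ v : HeightOneSpectrum (𝓞 ℚ), ¬ A.HasGoodReductionAt v → v ∈ S₀) →
    ((signedSelmerInfty A κ 1).comap
        (pushH1 κ.kerSubgroup ((↥(A.geomPrimaryTorsion 2))[(2 : ℤ)]).subtype (subtype_torsionBy_smul A 2)) :
          Set (subgroupH1 κ.kerSubgroup ↥((↥(A.geomPrimaryTorsion 2))[(2 : ℤ)]))).Finite →
    {c : subgroupH1 κ.kerSubgroup ↥((↥(A.geomPrimaryTorsion 2))[(2 : ℤ)]) |
      c ∈ unramifiedOutside κ.kerSubgroup ↥((↥(A.geomPrimaryTorsion 2))[(2 : ℤ)]) 2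
          (↑S₀ : Set (HeightOneSpectrum (𝓞 ℚ))) ∧
        (∀ (w : InfinitePlace ℚ) (σ : Field.absoluteGaloisGroup ℚ),
          Literature.NumberTheory.EllipticCurves.conjH1 κ.kerSubgroup ↥((↥(A.geomPrimaryTorsion 2))[(2 : ℤ)]) σ c ∈
            GreenbergSelmer.infKer κ.kerSubgroup ↥((↥(A.geomPrimaryTorsion 2))[(2 : ℤ)]) w) ∧
        (∀ (v : HeightOneSpectrum (𝓞 ℚ)), ((2 : ℕ) : 𝓞 ℚ) ∈ v.asIdeal → ∀ σ : Field.absoluteGaloisGroup ℚ,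
          A.conjH1 2 κ.kerSubgroup σ
              (pushH1 κ.kerSubgroup ((↥(A.geomPrimaryTorsion 2))[(2 : ℤ)]).subtype (subtype_torsionBy_smul A 2) c) ∈
            localKummerOverOfEmb A 2 κ.kerSubgroup (closureEmb (K := ℚ) (v.adicCompletion ℚ))
              (⨆ n : ℕ, signedLocalPoints κ (v.adicCompletion ℚ) A 1 n))}.Finite := by
  intro W _ _ A _ _ hCM hr hssW ha2W hCMA hssA ha2A he κ hκ S₀ hS2 hSW hSA hRA
  refine stub_sel2F W A hCM hr hssW ha2W hCMA hssA ha2A he κ hκ S₀ hS2 hSW hSA (hRA.subset ?_)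
  rintro c ⟨ha, hb, hc⟩
  exact stub_sel2L0 W A hCM hr hssW ha2W hCMA hssA ha2A he κ hκ c ha hb hc

/-! ## v8's `stub_sel2` from the three (PROVED) -/

/-- **sel2 from (U, T, L).** `Sel⁺(A/ℚ_∞)[2]` finite ⇒ (p536648) its residual preimage `R(A)` finite ⇒ (L) the residual
group `R♯(A)` finite ⇒ (T + naturality of `pushH1`, along the bijection `ẽ_*` of p537955) `R♯(W)` finite ⇒ (U)
`R(W) ⊆ R♯(W)` finite ⇒ (p536648) `Sel⁺(W/ℚ_∞)[2]` finite. -/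
theorem sel2_of_UTL (hTb : Summit.BirchSwinnertonDyer.BirchSwinnertonDyer.Theses.ThetaPartnerAtTwo.ResidualLocalTransportAtTwo) :
    ∀ (W : WeierstrassCurve ℚ) [W.IsElliptic] [W.IsGloballyMinimal] (A : WeierstrassCurve ℚ) [A.IsElliptic]
      [A.IsGloballyMinimal], ¬ W.HasCM → W.analyticRank = 0 → GoodSS W 2 → W.frobeniusTrace 2 = 0 →
      A.HasCM → GoodSS A 2 → A.frobeniusTrace 2 = 0 →
    (∃ e : WeierstrassCurve.geomTorsion W (2 : ℤ) ≃+ WeierstrassCurve.geomTorsion A (2 : ℤ),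
      ∀ (σ : Field.absoluteGaloisGroup ℚ) (P : WeierstrassCurve.geomTorsion W (2 : ℤ)), e (σ • P) = σ • e P) →
    ∀ (κ : ZpExtension ℚ 2), κ.IsCyclotomic →
      {s : signedSelmerInfty A κ 1 | (2 : ℕ) • s = 0}.Finite →
      {s : signedSelmerInfty W κ 1 | (2 : ℕ) • s = 0}.Finite := by
  intro W _ _ A _ _ hCM hr hssW ha2W hCMA hssA ha2A he κ hκ hfinA
  obtain ⟨S₀, hS2, hSW, hSA⟩ := exists_admissiblePlaces W A hssW.1 hssA.1
  obtain ⟨e'₀, he'₀, hbij₀⟩ := exists_pushH1_bijective W A 2 κ.kerSubgroup he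
  -- retype along the (definitional) identification `((2 : ℕ) : ℤ) = (2 : ℤ)` of the torsion exponents
  let e' : ↥((↥(W.geomPrimaryTorsion 2))[(2 : ℤ)]) ≃+ ↥((↥(A.geomPrimaryTorsion 2))[(2 : ℤ)]) := e'₀
  have he' : ∀ (σ : Field.absoluteGaloisGroup ℚ) (x : ↥((↥(W.geomPrimaryTorsion 2))[(2 : ℤ)])),
      e' (σ • x) = σ • e' x := he'₀
  have hbij : Function.Bijective (pushH1 κ.kerSubgroup e'.toAddMonoidHom he') := hbij₀
  -- shorthand for the two Kummer maps
  set kW := pushH1 κ.kerSubgroup ((↥(W.geomPrimaryTorsion 2))[(2 : ℤ)]).subtype (subtype_torsionBy_smul W 2)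
    with hkW
  set kA := pushH1 κ.kerSubgroup ((↥(A.geomPrimaryTorsion 2))[(2 : ℤ)]).subtype (subtype_torsionBy_smul A 2)
    with hkA
  set push := pushH1 κ.kerSubgroup e'.toAddMonoidHom he' with hpush
  -- R(A) finite
  have hRA : ((signedSelmerInfty A κ 1).comap kA :
      Set (subgroupH1 κ.kerSubgroup ↥((↥(A.geomPrimaryTorsion 2))[(2 : ℤ)]))).Finite :=
    (finite_signedSelmerInfty_twoTorsion_iff_finite_comap A hssA κ 1).mp hfinA
  -- R♯(A) finite
  have hRsharpA := sel2L_of_L0F W A hCM hr hssW ha2W hCMA hssA ha2A he κ hκ S₀ hS2 hSW hSA hRA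
  -- R♯(W) maps into R♯(A) under `push`
  set RW : Set (subgroupH1 κ.kerSubgroup ↥((↥(W.geomPrimaryTorsion 2))[(2 : ℤ)])) :=
    {c | c ∈ unramifiedOutside κ.kerSubgroup ↥((↥(W.geomPrimaryTorsion 2))[(2 : ℤ)]) 2
          (↑S₀ : Set (HeightOneSpectrum (𝓞 ℚ))) ∧
        (∀ (w : InfinitePlace ℚ) (σ : Field.absoluteGaloisGroup ℚ),
          Literature.NumberTheory.EllipticCurves.conjH1 κ.kerSubgroup ↥((↥(W.geomPrimaryTorsion 2))[(2 : ℤ)]) σ c ∈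
            GreenbergSelmer.infKer κ.kerSubgroup ↥((↥(W.geomPrimaryTorsion 2))[(2 : ℤ)]) w) ∧
        (∀ (v : HeightOneSpectrum (𝓞 ℚ)), ((2 : ℕ) : 𝓞 ℚ) ∈ v.asIdeal → ∀ σ : Field.absoluteGaloisGroup ℚ,
          W.conjH1 2 κ.kerSubgroup σ (kW c) ∈
            localKummerOverOfEmb W 2 κ.kerSubgroup (closureEmb (K := ℚ) (v.adicCompletion ℚ))
              (⨆ n : ℕ, signedLocalPoints κ (v.adicCompletion ℚ) W 1 n))} with hRW_def
  have hmaps : RW ⊆ push ⁻¹' {c : subgroupH1 κ.kerSubgroup ↥((↥(A.geomPrimaryTorsion 2))[(2 : ℤ)]) |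
      c ∈ unramifiedOutside κ.kerSubgroup ↥((↥(A.geomPrimaryTorsion 2))[(2 : ℤ)]) 2
          (↑S₀ : Set (HeightOneSpectrum (𝓞 ℚ))) ∧
        (∀ (w : InfinitePlace ℚ) (σ : Field.absoluteGaloisGroup ℚ),
          Literature.NumberTheory.EllipticCurves.conjH1 κ.kerSubgroup ↥((↥(A.geomPrimaryTorsion 2))[(2 : ℤ)]) σ c ∈
            GreenbergSelmer.infKer κ.kerSubgroup ↥((↥(A.geomPrimaryTorsion 2))[(2 : ℤ)]) w) ∧
        (∀ (v : HeightOneSpectrum (𝓞 ℚ)), ((2 : ℕ) : 𝓞 ℚ) ∈ v.asIdeal → ∀ σ : Field.absoluteGaloisGroup ℚ,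
          A.conjH1 2 κ.kerSubgroup σ (kA c) ∈
            localKummerOverOfEmb A 2 κ.kerSubgroup (closureEmb (K := ℚ) (v.adicCompletion ℚ))
              (⨆ n : ℕ, signedLocalPoints κ (v.adicCompletion ℚ) A 1 n))} := by
    rintro c ⟨ha, hb, hc⟩
    refine ⟨?_, ?_, ?_⟩
    · exact pushH1_mem_unramifiedOutside κ.kerSubgroup e'.toAddMonoidHom he' 2 _ ha
    · intro w σ
      have h := pushH1_mem_infKer κ.kerSubgroup e'.toAddMonoidHom he' w (hb w σ)
      rw [pushH1_conjH1] at h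
      exact h
    · exact sel2T_of_Ta hTb W A hCM hr hssW ha2W hCMA hssA ha2A he κ hκ e' he' c hc
  have hRsharpW : RW.Finite := (hRsharpA.preimage hbij.1.injOn).subset hmaps
  have hRWfin : ((signedSelmerInfty W κ 1).comap kW :
      Set (subgroupH1 κ.kerSubgroup ↥((↥(W.geomPrimaryTorsion 2))[(2 : ℤ)]))).Finite := by
    refine hRsharpW.subset fun c hc ↦ ?_
    exact stub_sel2U W A hCM hr hssW ha2W hCMA hssA ha2A he κ hκ S₀ hS2 hSW hSA c hc
  exact (finite_signedSelmerInfty_twoTorsion_iff_finite_comap W hssW κ 1).mpr hRWfin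

/-! ## The two other v8 stubs (unchanged) and the composition -/

/-- **GLUE 21417** (children ⟹ parent), kernel-certified: the lead's v8/v16 composition through the landed
`signedTransportAtTwo_of_gvBinders_selmerR` (p543010), fed the three CHILD DECLS of route rev 17/18 instead of the stubs. -/
theorem signedTransportAtTwoGlue_proof : Summit.BirchSwinnertonDyer.BirchSwinnertonDyer.Theses.ThetaPartnerAtTwo.SignedTransportAtTwoGlue :=
  fun hTb hLam hMT => signedTransportAtTwo_of_gvBinders_selmerR (sel2_of_UTL hTb) hLam hMT

end SplitGlue
end Summit.BirchSwinnertonDyer.BirchSwinnertonDyer.Theorems.SignedTransportAtTwo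

end
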